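import Summits.HodgeConjecture.HodgeConjecture.Theorems.K2LiuUndoublingSeparationOfSigns
import Summits.HodgeConjecture.HodgeConjecture.Theorems.K2LiuDoubledLiftSpanReduction
import HarnessLib

/-!
# UNDOUBLING + SEPARATION OF VARIABLES — socket #44∕45R `sig_K2LiuUndoublingSeparation` (U6 ED. 7 shape) PROVED

Track B ∕ hLiu418 = stmt-HodgeConjecture-24832, line `K2_Liu_CurveThetaSigs`, unit U6 `Cruxes/HLiu418/Lines/K2_Liu_CurveThetaSigs_U6_FirstTerm.lean`, socket
#44∕45R `sig_K2LiuUndoublingSeparation`; seat `hodgecm-mathlib-K2Liu-p03` (g3).  The theorem below has, token for token, the type of the socket in its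
ED. 7 shape = ED. 6 (tree 4aba65cdb1290499 :421–:498) with the LEAD F0P6-plan ruling of 2026-09-04 01:42Z applied: (T1) the sign binders `(ι₁, h₁V, hV)` on
`d_V` after `hdV0` (the letter's frame has signature `(1,1)` up to orientation at `ι₁` and is definite elsewhere — exactly the input of ★
`hasThetaMajorants_lineThetaKernelDatum`), (P1) `n′ := 2` (`e₁ : Fin 2 × Fin 1 ≃ Fin 2`, forced by the typing of `idxSplit e₂ e₁ e₁`), (T2) the hypothesis'
`Φ′` lies in the `ℂ`-span of the pure tensors `Φ₁ ⊠_ι Φ₂`, `ι = idxSplit e₂ e₁ e₁` (statement text: `K2/K2Liu-p03/g3/U6-ED7-P1-sig_K2LiuUndoublingSeparation.statement…txt`).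
The socket is then paid by `exact K2LiuUndoublingSeparation.undoublingSeparation` in the typist's tie edition.

PROOF (road `K2/K2Liu-p03/g3/ROAD-44-45R-Assembly.K2Liu-p03-g3.md`, all organs ★): Step 1′ ★ `K2LiuDoubledLiftSpanReduction` (the pairing is `ℂ`-linear in
`Φ` ⇒ some pure tensor `Φ₁ ⊠_ι Φ₂` has non-zero pairing); Steps 2–7 ★ `K2LiuUndoublingSeparationOfSigns.exists_undoubledPairing_ne_zero_of_pureTensor_of_signs`
(★ `K2LiuDoubledKernelAtIota` undoubling on `ι(G × G)` = orthogonal-sum see-saw [HarrisKudlaSweet1996 (1.25)–(1.30)], ★ `K2LiuSlotOnePermutationFrame` ∕ ★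
`K2LiuSlotTwoPermutationFrame` (both slots moved to the letter frame `d_V` on the line `⟨−a′⟩`: permutation isometry, rescaling by `−1`, ★ mirror `conj θ_{Φ,λ⁻¹} =
θ_{Φ̄,λ}`, character twists), ★ `K2LiuDoubledLiftUndoubled` (under the `q`-integral), ★ `K2LiuQuotientMeasureTransport` (`ν :=` push-forward of `μ_W` to
`[U(⟨−a′⟩)]`, finite, invariant, open-positive since `μ_W ≠ 0`), ★ `K2LiuUndoublingSeparationPureTensor` (`W₂ := conj(η₁ ∘ ιA)~ · w₂`, `f′ := (f ∘ τ⁻¹) · η̄₂`));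
Step 8: `a′ ↦ −a′`, `hρ :=` ★ `hasThetaMajorants_lineThetaKernelDatum … (−a′) ι₁ h₁V hV`.

No definition, no instance, no named fact, no `sorry`; axioms ⊆ {propext, Classical.choice, Quot.sound}.

## References
* [HarrisKudlaSweet1996] M. Harris, S. Kudla, W. J. Sweet, *Theta dichotomy for unitary groups*, J. AMS 9 (1996), §1 Lem. 1.1 p. 953, (1.25)–(1.30), Lem. 1.3.
* [Liu2021] Y. Liu, Camb. J. Math. 9 (2021), App. B (B.7) p. 104, Thm. B.4 (1) (c), Cor. B.5 (3), Lem. B.11.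
* [GelbartRogawski1991] S. Gelbart, J. Rogawski, Invent. Math. 105 (1991), §3.
* [Weil1964] A. Weil, Acta Math. 111 (1964), Chap. III n° 41 Lemme 5 p. 194, Thm. 6 p. 193.

HONEST LABEL: HC_CM is proved only modulo the 7 printed citations (2 remaining named inputs: hLiu418 = stmt-HodgeConjecture-24832, h413 =
stmt-HodgeConjecture-24833) until rung 0 closes; this file pays one socket of the U6 line and moves no counter by itself.
-/

set_option autoImplicit false

set_option linter.dupNamespace false

noncomputable section

open scoped Matrix Topology
open NumberField IsDedekindDomain MeasureTheory Filter

namespace Summit.HodgeConjecture.HodgeConjecture.Cruxes.HLiu418.K2LiuUndoublingSeparation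

open Literature.NumberTheory.Automorphic Literature.NumberTheory.GaloisRepresentations
open Literature.NumberTheory.GelbartRogawski1991 Literature.NumberTheory.GelbartRogawski1991.GRConstruction
open Literature.NumberTheory.K2Lit.SiegelDoubled
open Literature.NumberTheory.Automorphic.UnitaryGroup (adelicGroupData adelicVal)
open Literature.NumberTheory.Automorphic.UnitaryGroup.CotangentForms (toQuotFun)
open Literature.NumberTheory.Automorphic.IdeleClassGroup
open Literature.NumberTheory.Automorphic.Liu2021
open Literature.NumberTheory.Automorphic.Liu2021.Def411WeilCarriers
open Literature.NumberTheory.Automorphic.Liu2021.Def411WeilCarriersDoubling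
open Literature.NumberTheory.GelbartRogawski1991.UnitaryDualPair
open Literature.NumberTheory.Weil1964
open Literature.RepresentationTheory.Liu2021
open Literature.NumberTheory.K2Lit.DoubledLineTheta
open Summit.HodgeConjecture.HodgeConjecture.Cruxes.HLiu418
open Summit.HodgeConjecture.HodgeConjecture.Cruxes.HLiu418.K2LiuDoubledLiftSpanReduction
open Summit.HodgeConjecture.HodgeConjecture.Cruxes.HLiu418.K2LiuUndoublingSeparationOfSigns

/-- **UNDOUBLING + SEPARATION OF VARIABLES** (socket #44∕45R, ED. 7 shape): if the doubled theta pairing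
`doublingPairing μ (toQuotFun₂ (g ↦ Θ̃^□_{Φ′}(f)(ι(ιA g₁, ιA g₂)))) w₁ w₂` of some `Φ′` in the span of the pure tensors `Φ₁ ⊠_ι Φ₂` is non-zero (kernel at
`λ⁻¹` on a line `⟨a′⟩`, `μ_W` finite invariant), then for some line (namely `⟨−a′⟩`), Weil majorants from the sign data, a finite invariant open-positive `ν`,
pure data `Φ₁, Φ₂ ∈ 𝒮(𝔸²)`, a weight `f′` and an integrable slot-2 weight `W₂`:
`doublingPairing μ (x ↦ ∫ f′(q) · conj θ_{Φ₁}(x₁, q) · θ_{Φ₂}(x₂, q) dν(q)) w₁ W₂ ≠ 0`, `θ_Φ(x, q) = (lineThetaKernelDatum L 2 e₁ dV … λ … a′ hρ).thetaKer Φ (mk (ιA x̃)⁻¹, q)`.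
[cite: HarrisKudlaSweet1996, §1 Lem. 1.1 p. 953, (1.25)–(1.30), Lem. 1.3] [cite: Liu2021, App. B (B.7) p. 104, Thm. B.4 (1) (c), Cor. B.5 (3)]
[cite: GelbartRogawski1991, §3] [cite: Weil1964, Chap. III n° 41 Lemme 5 p. 194] -/
theorem undoublingSeparation :
    ∀ (L : Type) [Field L] [NumberField L] [IsCMField L] (H : Matrix (Fin 2) (Fin 2) L)
      (dV : Fin 2 → L) (hdV : ∀ i, IsCMField.complexConj L (dV i) = dV i) (hdV0 : ∀ i, dV i ≠ 0)
      (ι₁ : L →+* ℂ) (h₁V : ∃ i₀ : Fin 2, (∀ i, i ≠ i₀ → 0 < (ι₁ (dV i)).re) ∨ ∀ i, i ≠ i₀ → (ι₁ (dV i)).re < 0)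
      (hV : ∀ τ : L →+* ℂ, InfinitePlace.mk τ ≠ InfinitePlace.mk ι₁ → (∀ i, 0 < (τ (dV i)).re) ∨ ∀ i, (τ (dV i)).re < 0)
      (e₁ : Fin 2 × Fin 1 ≃ Fin 2) {n'' : ℕ} (e₂ : Fin (2 + 2) × Fin 1 ≃ Fin n'')
      (lam : Literature.NumberTheory.Automorphic.IdeleClassGroup L →ₜ* Circle) (hlam : IsConjugateSymplectic L lam)
      (μ : Measure (adelicGroupData (↥(maximalRealSubfield L)) L (IsCMField.complexConj L) 2 H).automorphicQuotient) [IsFiniteMeasure μ]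
      (ιA : (adelicGroupData (↥(maximalRealSubfield L)) L (IsCMField.complexConj L) 2 H).Adelic →*
        ↥(UnitaryGroup.adelic (↥(maximalRealSubfield L)) L (IsCMField.complexConj L) 2 (Matrix.diagonal dV)))
      (hιAc : Continuous ιA)
      (hιAr : ∀ ⦃γ : (adelicGroupData (↥(maximalRealSubfield L)) L (IsCMField.complexConj L) 2 H).Adelic⦄,
        γ ∈ (UnitaryGroup.toAdelic (↥(maximalRealSubfield L)) L (IsCMField.complexConj L) 2 H).range →
          ιA γ ∈ (UnitaryGroup.toAdelic (↥(maximalRealSubfield L)) L (IsCMField.complexConj L) 2 (Matrix.diagonal dV)).range)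
      [CompactSpace (adelicGroupData (↥(maximalRealSubfield L)) L (IsCMField.complexConj L) 2 H).automorphicQuotient]
      (w₁ w₂ : (adelicGroupData (↥(maximalRealSubfield L)) L (IsCMField.complexConj L) 2 H).automorphicQuotient → ℂ),
      Integrable w₁ μ → Integrable w₂ μ →
      (∃ (a' : (↥(maximalRealSubfield L))ˣ)
        (hρD : HasThetaMajorants fun
          (p : ↥(UnitaryGroup.adelic (↥(maximalRealSubfield L)) L (IsCMField.complexConj L) (2 + 2)
              (Matrix.diagonal (dD L e₁ dV hdV (fun _ : Fin 1 => (1 : L)) (fun _ => map_one _)))) ×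
            ↥(UnitaryGroup.adelic (↥(maximalRealSubfield L)) L (IsCMField.complexConj L) 1 (JW (↥(maximalRealSubfield L)) L a')))
          (Φ : piSchwartzBruhat (↥(maximalRealSubfield L)) (Fin n'')) =>
            pairRep (↥(maximalRealSubfield L)) L (IsCMField.complexConj L) (2 + 2) 1 e₂
              (Matrix.diagonal (dD L e₁ dV hdV (fun _ : Fin 1 => (1 : L)) (fun _ => map_one _))) (JW (↥(maximalRealSubfield L)) L a')
              (chiSplittingLine L e₂ (dD L e₁ dV hdV (fun _ : Fin 1 => (1 : L)) (fun _ => map_one _))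
                (dD_conj L e₁ dV hdV (fun _ : Fin 1 => (1 : L)) (fun _ => map_one _))
                (dD_ne_zero L e₁ dV hdV (fun _ : Fin 1 => (1 : L)) (fun _ => map_one _) hdV0 (fun _ => one_ne_zero))
                (toHeckeCharacter L lam⁻¹) (isUnitary_toHeckeCharacter L lam⁻¹)
                ((isOscillatorChar_toHeckeCharacter_iff lam⁻¹).mpr (K2LiuConjugateSymplecticInv.IsConjugateSymplectic.inv hlam)) (TW (↥(maximalRealSubfield L)) a')
                (isUnit_det_TW (↥(maximalRealSubfield L)) a') (JW (↥(maximalRealSubfield L)) L a') (JW_eq (↥(maximalRealSubfield L)) L a'))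
              p Φ)
        (μW : @Measure (↥(UnitaryGroup.adelic (↥(maximalRealSubfield L)) L (IsCMField.complexConj L) 1 (JW (↥(maximalRealSubfield L)) L a')) ⧸
          (UnitaryGroup.toAdelic (↥(maximalRealSubfield L)) L (IsCMField.complexConj L) 1 (JW (↥(maximalRealSubfield L)) L a')).range) (borel _))
        (_ : @IsFiniteMeasure _ (borel _) μW)
        (_ : @SMulInvariantMeasure
          ↥(UnitaryGroup.adelic (↥(maximalRealSubfield L)) L (IsCMField.complexConj L) 1 (JW (↥(maximalRealSubfield L)) L a'))
          (↥(UnitaryGroup.adelic (↥(maximalRealSubfield L)) L (IsCMField.complexConj L) 1 (JW (↥(maximalRealSubfield L)) L a')) ⧸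
            (UnitaryGroup.toAdelic (↥(maximalRealSubfield L)) L (IsCMField.complexConj L) 1 (JW (↥(maximalRealSubfield L)) L a')).range)
          _ (borel _) μW)
        (Φ' : piSchwartzBruhat (↥(maximalRealSubfield L)) (Fin n''))
        (_ : Φ' ∈ Submodule.span ℂ (Set.range fun p : ↥(piSchwartzBruhat (↥(maximalRealSubfield L)) (Fin 2)) × ↥(piSchwartzBruhat (↥(maximalRealSubfield L)) (Fin 2)) =>
          Literature.NumberTheory.Weil1964.sumTensor (↥(maximalRealSubfield L)) (Literature.NumberTheory.GelbartRogawski1991.GRConstruction.idxSplit e₂ e₁ e₁) p.1 p.2))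
        (f : C(↥(UnitaryGroup.adelic (↥(maximalRealSubfield L)) L (IsCMField.complexConj L) 1 (JW (↥(maximalRealSubfield L)) L a')) ⧸
          (UnitaryGroup.toAdelic (↥(maximalRealSubfield L)) L (IsCMField.complexConj L) 1 (JW (↥(maximalRealSubfield L)) L a')).range, ℂ)),
        doublingPairing (adelicGroupData (↥(maximalRealSubfield L)) L (IsCMField.complexConj L) 2 H) μ
          (toQuotFun₂ (adelicGroupData (↥(maximalRealSubfield L)) L (IsCMField.complexConj L) 2 H)
            (fun g => @doubledLineThetaLift L _ _ _ 2 1 2 e₁ dV hdV (fun _ : Fin 1 => (1 : L)) (fun _ => map_one _) n'' e₂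
              hdV0 (fun _ => one_ne_zero) lam⁻¹ (K2LiuConjugateSymplecticInv.IsConjugateSymplectic.inv hlam) a' hρD (borel _) μW Φ' f
              (iotaV L e₁ dV hdV (fun _ : Fin 1 => (1 : L)) (fun _ => map_one _) (ιA g.1, ιA g.2))))
          w₁ w₂ ≠ 0) →
      ∃ (a' : (↥(maximalRealSubfield L))ˣ)
        (hρ : HasThetaMajorants fun
          (p : ↥(UnitaryGroup.adelic (↥(maximalRealSubfield L)) L (IsCMField.complexConj L) 2 (Matrix.diagonal dV)) ×
            ↥(UnitaryGroup.adelic (↥(maximalRealSubfield L)) L (IsCMField.complexConj L) 1 (JW (↥(maximalRealSubfield L)) L a')))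
          (Φ : piSchwartzBruhat (↥(maximalRealSubfield L)) (Fin 2)) =>
            pairRep (↥(maximalRealSubfield L)) L (IsCMField.complexConj L) 2 1 e₁ (Matrix.diagonal dV) (JW (↥(maximalRealSubfield L)) L a')
              (chiSplittingLine L e₁ dV hdV hdV0 (toHeckeCharacter L lam) (isUnitary_toHeckeCharacter L lam)
                ((isOscillatorChar_toHeckeCharacter_iff lam).mpr hlam) (TW (↥(maximalRealSubfield L)) a')
                (isUnit_det_TW (↥(maximalRealSubfield L)) a') (JW (↥(maximalRealSubfield L)) L a') (JW_eq (↥(maximalRealSubfield L)) L a'))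
              p Φ),
        letI : MeasurableSpace (↥(UnitaryGroup.adelic (↥(maximalRealSubfield L)) L (IsCMField.complexConj L) 1
            (JW (↥(maximalRealSubfield L)) L a')) ⧸
              (UnitaryGroup.toAdelic (↥(maximalRealSubfield L)) L (IsCMField.complexConj L) 1 (JW (↥(maximalRealSubfield L)) L a')).range) :=
          borel _
        ∃ (ν : Measure (↥(UnitaryGroup.adelic (↥(maximalRealSubfield L)) L (IsCMField.complexConj L) 1 (JW (↥(maximalRealSubfield L)) L a')) ⧸
            (UnitaryGroup.toAdelic (↥(maximalRealSubfield L)) L (IsCMField.complexConj L) 1 (JW (↥(maximalRealSubfield L)) L a')).range))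
          (_ : IsFiniteMeasure ν)
          (_ : SMulInvariantMeasure ↥(UnitaryGroup.adelic (↥(maximalRealSubfield L)) L (IsCMField.complexConj L) 1 (JW (↥(maximalRealSubfield L)) L a'))
            (↥(UnitaryGroup.adelic (↥(maximalRealSubfield L)) L (IsCMField.complexConj L) 1 (JW (↥(maximalRealSubfield L)) L a')) ⧸
              (UnitaryGroup.toAdelic (↥(maximalRealSubfield L)) L (IsCMField.complexConj L) 1 (JW (↥(maximalRealSubfield L)) L a')).range) ν)
          (_ : ν.IsOpenPosMeasure)
          (Φ₁ Φ₂ : piSchwartzBruhat (↥(maximalRealSubfield L)) (Fin 2))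
          (f' : C(↥(UnitaryGroup.adelic (↥(maximalRealSubfield L)) L (IsCMField.complexConj L) 1 (JW (↥(maximalRealSubfield L)) L a')) ⧸
            (UnitaryGroup.toAdelic (↥(maximalRealSubfield L)) L (IsCMField.complexConj L) 1 (JW (↥(maximalRealSubfield L)) L a')).range, ℂ))
          (W₂ : (adelicGroupData (↥(maximalRealSubfield L)) L (IsCMField.complexConj L) 2 H).automorphicQuotient → ℂ),
          Integrable W₂ μ ∧
          doublingPairing (adelicGroupData (↥(maximalRealSubfield L)) L (IsCMField.complexConj L) 2 H) μ
            (fun x => ∫ q, f' q * (starRingEnd ℂ (toQuotFun (adelicGroupData (↥(maximalRealSubfield L)) L (IsCMField.complexConj L) 2 H)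
                (fun y => (lineThetaKernelDatum L 2 e₁ dV hdV hdV0 lam hlam a' hρ).thetaKer Φ₁ (QuotientGroup.mk (ιA y)⁻¹, q)) x.1) *
              toQuotFun (adelicGroupData (↥(maximalRealSubfield L)) L (IsCMField.complexConj L) 2 H)
                (fun y => (lineThetaKernelDatum L 2 e₁ dV hdV hdV0 lam hlam a' hρ).thetaKer Φ₂ (QuotientGroup.mk (ιA y)⁻¹, q)) x.2) ∂ν)
            w₁ W₂ ≠ 0 := by
  intro L _ _ _ H dV hdV hdV0 ι₁ h₁V hV e₁ n'' e₂ lam hlam μ _ ιA hιAc hιAr _ w₁ w₂ hw₁ hw₂ hhyp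
  obtain ⟨a', hρD, μW, hfin, hinv, Φ', hΦ', f, hne⟩ := hhyp
  letI iA : MeasurableSpace (↥(UnitaryGroup.adelic (Fp L) L (IsCMField.complexConj L) 1 (JW (Fp L) L a')) ⧸ (UnitaryGroup.toAdelic (Fp L) L (IsCMField.complexConj L) 1 (JW (Fp L) L a')).range) := borel _
  haveI : BorelSpace (↥(UnitaryGroup.adelic (Fp L) L (IsCMField.complexConj L) 1 (JW (Fp L) L a')) ⧸ (UnitaryGroup.toAdelic (Fp L) L (IsCMField.complexConj L) 1 (JW (Fp L) L a')).range) := ⟨rfl⟩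
  letI iN : MeasurableSpace (↥(UnitaryGroup.adelic (Fp L) L (IsCMField.complexConj L) 1 (JW (Fp L) L (-a'))) ⧸ (UnitaryGroup.toAdelic (Fp L) L (IsCMField.complexConj L) 1 (JW (Fp L) L (-a'))).range) := borel _
  haveI : BorelSpace (↥(UnitaryGroup.adelic (Fp L) L (IsCMField.complexConj L) 1 (JW (Fp L) L (-a'))) ⧸ (UnitaryGroup.toAdelic (Fp L) L (IsCMField.complexConj L) 1 (JW (Fp L) L (-a'))).range) := ⟨rfl⟩
  haveI := hfin
  haveI := hinv
  -- Step 1′: from the span to a pure tensor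
  obtain ⟨T, ⟨p, rfl⟩, hT⟩ := exists_mem_doublingPairing_doubledLineThetaLift_ne_zero L e₁ H dV hdV (fun _ : Fin 1 => (1 : L)) (fun _ => map_one _)
    e₂ hdV0 (fun _ => one_ne_zero) lam⁻¹ (K2LiuConjugateSymplecticInv.IsConjugateSymplectic.inv hlam) a' hρD ιA hιAc hιAr μW f μ hw₁ hw₂ _ hΦ' hne
  -- Steps 2–7: undouble, separate, transport to the line `⟨−a′⟩`
  obtain ⟨ν, hν₁, hν₂, hν₃, Ψ₁, Ψ₂, f', W₂, hW₂, hDP⟩ := exists_undoubledPairing_ne_zero_of_pureTensor_of_signs L H e₁ e₂ dV hdV hdV0 ι₁ h₁V hV lam hlam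
    a' hρD μ ιA hιAc hιAr μW f w₁ w₂ hw₂ p.1 p.2 hT
  -- Step 8: the line `⟨−a′⟩` and its majorant from the sign data
  exact ⟨-a', hasThetaMajorants_lineThetaKernelDatum L e₁ dV hdV hdV0 lam hlam (-a') ι₁ h₁V hV, ν, hν₁, hν₂, hν₃, Ψ₁, Ψ₂, f', W₂, hW₂, hDP⟩

end Summit.HodgeConjecture.HodgeConjecture.Cruxes.HLiu418.K2LiuUndoublingSeparation

end
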